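import Literature.NumberTheory.GaloisCohomology.Howard2004.TauEigencocycleLocalizationProofs
import Literature.NumberTheory.GaloisCohomology.Howard2004.KolyvaginPrimeOfFrobeniusProofs
import HarnessLib

/-!
# Howard 2004, Lemma 1.6.2 ON A `DVRSetting` (char. 0): «infinitely many `λ ∈ 𝓛^{(s)} = 𝓛 ∩ 𝓛_s(T)`
# with `c^± ≠ 0 ⟹ loc_λ(c^±) ≠ 0`» — the hypotheses of the abstract lemma discharged from H.0–H.5

Topic `NumberTheory/GaloisCohomology/Howard2004` (first input of Lemma 1.6.4 = the residual Galois
input of the print leaf G87 `Howard2004.thm161_dvrKolyvaginBound`; cell `pub/bsd-print-x9`, seat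
`bsd-line-x10b-p1-w6` g8; assembles `TauEigencocycleLocalizationProofs` (Lemma 1.6.2 on abstract
hypotheses, seats w2 g15 / w6 g8) with `KolyvaginPrimeOfFrobeniusProofs` («`ℓ ∈ 𝓛_{2k−1}(T)`»)).
THEOREMS ONLY: no definition, no named fact, no instance, no notation, no `sorry`.

Printed source.  B. Howard, *The Heegner point Kolyvagin system*, Compositio Math. **140** (2004) =
arXiv:1202.6340, Lemma 1.6.2 (arXiv Lemma 2.6.2, p. 11 L30–58) in the setting of §1.6 (p. 11
L13–38: `R` a DVR, `(T, F, 𝓛)` with H.0–H.5, «`𝓛_s(T) ⊂ 𝓛` for `s ≫ 0`», `𝓛^{(k)} = 𝓛 ∩ 𝓛_k(T)`).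

What is here — every abstract hypothesis of `ResidualTau.exists_inert_prime_localization_ne_zero`
read off a `DVRSetting` `S` with `S.SatisfiesH`, at a level `j` with `𝔪^{e_j} ⊆ (p^s)`:
* §1 `isScalarLinear_rhobar` (`T̄` is an `R_j`-linear representation: H.1's presentation
  `T^{(j)} ↠ T̄` of the `R_j`-linear level), `isUnit_two` (`2 ∈ R_j^×`: `p` odd, residue field of
  characteristic `p`), `rhobar_apply_eq_of_forall_apply_eq` (a `σ` trivial on `T^{(j)}` is trivial
  on `T̄`);
* §2 **`DVRSetting.exists_mem_primes_localization_ne_zero`** — LEMMA 1.6.2 in `DVRSetting`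
  currency: for `τ`-eigencocycles `φ⁺, φ⁻` on `T̄` (`φ^±(g^τ) = ±θ(φ^± g)`, `θ = (S.A j).θ`) with
  non-zero classes, `p ≠ 0` in `R` handled by the level `j`, every finite set `S₀` of places:
  a place `v ∉ S₀`, `v ∉ Σ(F)`, **`v ∈ 𝓛 ∩ 𝓛_s(T)`** (`S.L`, `S.T.kolyvaginPrimes p s`), with a
  Frobenius `g^τ g` at a prime `𝔔 ∣ v` acting trivially on `T^{(j)}`, the evaluation criterion at
  `𝔔` for every cocycle vanishing on `I_𝔔`, and **`loc_v [φ^±] ≠ 0`**; the `Γ_L` of the proof is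
  `ConjugationDatum.exists_standard_open_subgroup` for `T^{(j)}` and `μ_{p^s}`, and «`c^± ≠ 0 ⟹
  φ^±|_{Γ_L} ≠ 0`» is H.2 (`H2Tower`) through `exists_mem_apply_ne_zero_of_resSubgroup_injOn`;
* §3 `DVRSetting.exists_mem_primes_localization_ne_zero_single` — one class.

HONEST FRAMING.  Needs `(p : R) ≠ 0` (see the FINDING in `KolyvaginPrimeOfFrobeniusProofs`: print's
coefficient rings formally include characteristic `p`, where `𝓛_s(T)` degenerates; all printed and
all cell uses are characteristic `0`).  Not Lemma 1.6.4, not Thm. 1.6.1; `thm161_dvrKolyvaginBound`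
is NOT proved; no summit statement is proved; the Birch–Swinnerton-Dyer conjecture is not proved by
any of this.  Input named fact: Čebotarev (`Automorphic.chebotarev_artinRep`, proved in the tree).

References: [Howard2004HeegnerKolyvagin] §1.3 H.1/H.2/H.5, Def. 1.2.1, §1.6, Lemma 1.6.2.
-/

set_option autoImplicit false

noncomputable section

open Function NumberField IsDedekindDomain Field
open scoped NumberField ContRepresentation Classical Pointwise

namespace Literature.NumberTheory.GaloisCohomology.Howard2004

open Literature.NumberTheory.GaloisRepresentations
open Literature.NumberTheory.GaloisRepresentations.DiscreteGaloisModule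
open Literature.NumberTheory.EllipticCurves

namespace DVRSetting

variable {p : ℕ} [Fact p.Prime] {K : Type} [Field K] [NumberField K]
  {R : Type} [CommRing R] [IsDomain R] [IsDiscreteValuationRing R] [Algebra ℤ_[p] R]
  {N : ℕ → Type} [∀ k, AddCommGroup (N k)] [∀ k, TopologicalSpace (N k)]
  [∀ k, DiscreteTopology (N k)] [∀ k, Module R (N k)]
  {Rk : ℕ → Type} [∀ k, CommRing (Rk k)] [∀ k, IsLocalRing (Rk k)] [∀ k, TopologicalSpace (Rk k)]
  [∀ k, DiscreteTopology (Rk k)] [∀ k, Algebra ℤ_[p] (Rk k)] [∀ k, Algebra R (Rk k)]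
  [∀ k, Module (Rk k) (N k)] [∀ k, IsScalarTower R (Rk k) (N k)]
  {Nbar : Type} [AddCommGroup Nbar] [TopologicalSpace Nbar] [DiscreteTopology Nbar]
  [∀ k, Module (Rk k) Nbar]
  {Nq : ℕ → Finset (HeightOneSpectrum (𝓞 K)) → Type} [∀ k n, AddCommGroup (Nq k n)]
  [∀ k n, TopologicalSpace (Nq k n)] [∀ k n, DiscreteTopology (Nq k n)]
  [∀ k n, Module (Rk k) (Nq k n)] [∀ k n, Module R (Nq k n)]
  [∀ k n, IsScalarTower R (Rk k) (Nq k n)]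

/-! ## §1 Hypotheses of the abstract lemma, read off H.0–H.5 -/

/-- **`T̄` is `R_j`-linear** (H.1: `T̄` is the `R_j`-linear quotient `T^{(j)}/𝔪 T^{(j)}` of the
`R_j`-linear level). [cite: Howard2004HeegnerKolyvagin, §1.3 H.1 (arXiv p. 7 L59)] -/
theorem isScalarLinear_rhobar (S : DVRSetting p K R N Rk Nbar Nq) (hy : S.SatisfiesH) (j : ℕ) :
    S.ρbar.IsScalarLinear (Rk j) := by
  intro σ r x
  obtain ⟨m, rfl⟩ := (hy.h1 j).1.surjective x
  rw [← LinearMap.map_smul, ← (hy.h1 j).1.equivariant, ← (hy.h1 j).1.equivariant, hy.scalarLinear j,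
    LinearMap.map_smul]

/-- **`2` is a unit of `R_j`** (`p` odd: `2 ∉ 𝔪_R` since the residue field has characteristic `p`).
[cite: Howard2004HeegnerKolyvagin, §1 conventions (arXiv p. 4 L47–52) and journal §1 (p odd)] -/
theorem isUnit_two (S : DVRSetting p K R N Rk Nbar Nq) (hy : S.SatisfiesH) (j : ℕ) :
    IsUnit (2 : Rk j) := by
  have h2R : IsUnit (2 : R) := by
    by_contra h
    have hmem : (2 : R) ∈ IsLocalRing.maximalIdeal R :=
      (IsLocalRing.mem_maximalIdeal _).mpr (mem_nonunits_iff.mpr h)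
    haveI := hy.coeffRing.charP_residueField
    have h0 : ((2 : ℕ) : IsLocalRing.ResidueField R) = 0 := by
      rw [Nat.cast_ofNat, ← map_ofNat (IsLocalRing.residue R) 2, IsLocalRing.residue_eq_zero_iff]
      exact hmem
    have hdvd : p ∣ 2 := (CharP.cast_eq_zero_iff (IsLocalRing.ResidueField R) p 2).mp h0
    have hp : p.Prime := Fact.out
    exact hy.p_odd (le_antisymm (Nat.le_of_dvd two_pos hdvd) hp.two_le)
  have h := h2R.map (algebraMap R (Rk j))
  rwa [map_ofNat] at h

/-- **An element acting trivially on `T^{(j)}` acts trivially on `T̄`** (`T̄` is a quotient of every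
level). [cite: Howard2004HeegnerKolyvagin, §1.3 H.1 (arXiv p. 7 L59)] -/
theorem rhobar_apply_eq_of_forall_apply_eq (S : DVRSetting p K R N Rk Nbar Nq) (hy : S.SatisfiesH)
    (j : ℕ) {g : absoluteGaloisGroup K} (hg : ∀ x : N j, S.T.ρ j g x = x) (x : Nbar) :
    S.ρbar g x = x := by
  obtain ⟨m, rfl⟩ := (hy.h1 j).1.surjective x
  rw [← (hy.h1 j).1.equivariant, hg]

/-! ## §2 Lemma 1.6.2 on a `DVRSetting`, both eigenclasses -/

/-- **Howard 2004, Lemma 1.6.2, in `DVRSetting` currency (characteristic `0`).**  Let `S` be a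
`DVRSetting` with `S.SatisfiesH`, `p ≠ 0` in `R` witnessed by a level `j` with `𝔪^{e_j} ⊆ (p^s)`
(`exists_maximalIdeal_pow_e_le_span_pow`), `𝓛_s(T) ⊆ 𝓛` (from `LargePrimes`), and let `φ⁺, φ⁻` be
continuous cocycles on `T̄` with `φ⁺(g^τ) = θ(φ⁺ g)`, `φ⁻(g^τ) = −θ(φ⁻ g)` (`θ = (S.A j).θ`, the
`G_ℚ`-structure of H.5(a)) and NON-ZERO classes `c^± ∈ H¹(K, T̄)`.  Then for every finite set `S₀`
of finite places there is `v ∉ S₀`, `v ∉ Σ(F)`, with **`v ∈ 𝓛` and `v ∈ 𝓛_s(T)`**, an element `g`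
with `x = g^τ g` an arithmetic Frobenius at a prime `𝔔 ∣ v` of `\bar ℤ_K` acting trivially on
`T^{(j)}`, the evaluation criterion `loc_v [ψ] = 0 ↔ ψ(x) = 0` for every cocycle `ψ` vanishing on
`I_𝔔`, and **`loc_v [φ⁺] ≠ 0`, `loc_v [φ⁻] ≠ 0` in `H¹(K_v, T̄)`** — «there are infinitely many
primes `λ ∈ 𝓛^{(2k−1)}` such that `c^± ≠ 0 ⟹ loc_λ(c^±) ≠ 0`».
[cite: Howard2004HeegnerKolyvagin, Lemma 1.6.2 (arXiv:1202.6340 Lemma 2.6.2, p. 11 L30–58)] -/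
theorem exists_mem_primes_localization_ne_zero [Finite Nbar] [∀ k, Finite (N k)]
    (S : DVRSetting p K R N Rk Nbar Nq) (hy : S.SatisfiesH) (hC : Automorphic.chebotarev_artinRep)
    {s : ℕ} (hLs : S.T.kolyvaginPrimes p s ⊆ S.L) {j : ℕ}
    (hj : IsLocalRing.maximalIdeal R ^ S.e j ≤ Ideal.span {((p : ℕ) : R) ^ s})
    (φp φm : contOneCocycles S.ρbar.toTopRep)
    (hφp : ∀ g, φp.1 (S.cd.conj g) = (S.A j).θ (φp.1 g))
    (hφm : ∀ g, φm.1 (S.cd.conj g) = -(S.A j).θ (φm.1 g))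
    (hcp : oneCocycleClass S.ρbar.toTopRep φp ≠ 0) (hcm : oneCocycleClass S.ρbar.toTopRep φm ≠ 0)
    {S₀ : Set (HeightOneSpectrum (𝓞 K))} (hS₀ : S₀.Finite) :
    ∃ v : HeightOneSpectrum (𝓞 K), v ∉ S₀ ∧ (Sum.inr v : Place K) ∉ S.Sigma ∧ v ∈ S.L ∧
      v ∈ S.T.kolyvaginPrimes p s ∧
      ∃ g : absoluteGaloisGroup K, (∀ x : N j, S.T.ρ j (S.cd.conj g * g) x = x) ∧
        ∃ 𝔔 ∈ v.primesAbove, IsArithFrobAt (𝓞 K) (S.cd.conj g * g) 𝔔 ∧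
          (∀ ψ : contOneCocycles S.ρbar.toTopRep,
            (∀ i ∈ 𝔔.inertia (absoluteGaloisGroup K), ψ.1 i = 0) →
              (galoisCohomology.localization S.ρbar (Sum.inr v) 1 (oneCocycleClass S.ρbar.toTopRep ψ)
                = 0 ↔ ψ.1 (S.cd.conj g * g) = 0)) ∧
          galoisCohomology.localization S.ρbar (Sum.inr v) 1 (oneCocycleClass S.ρbar.toTopRep φp)
            ≠ 0 ∧
          galoisCohomology.localization S.ρbar (Sum.inr v) 1 (oneCocycleClass S.ρbar.toTopRep φm)
            ≠ 0 := by
  have hp : p.Prime := Fact.out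
  haveI : NeZero (p ^ s) := ⟨pow_ne_zero s hp.ne_zero⟩
  -- Howard's `Γ_L`: the standard open subgroup for `T^{(j)}` and `μ_{p^s}`
  obtain ⟨Λ, hΛo, hΛn, hΛc, hΛt, hΛμ, hΛle⟩ := S.cd.exists_standard_open_subgroup (S.T.ρ j) (p ^ s)
  have hΛt' : ∀ g ∈ Λ, ∀ x : Nbar, S.ρbar g x = x :=
    fun g hg => S.rhobar_apply_eq_of_forall_apply_eq hy j (hΛt g hg)
  -- H.2: `c ≠ 0 ⟹ φ|_Λ ≠ 0`
  obtain ⟨ΓF, -, -, hFc, hFt, hinj⟩ := hy.h2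
  have hle : ΓF ⊓ (⨅ n : ℕ, (DiscreteGaloisModule.mu K (p ^ n)).ker) ≤ Λ :=
    hΛle ΓF _ hFc (fun g hg x => hFt j g hg x) (iInf_ker_mu_le_ker_mu_pow p s)
  have hnep : ∃ g ∈ Λ, φp.1 g ≠ 0 :=
    exists_mem_apply_ne_zero_of_resSubgroup_injOn S.ρbar hle hinj φp hcp
  have hnem : ∃ g ∈ Λ, φm.1 g ≠ 0 :=
    exists_mem_apply_ne_zero_of_resSubgroup_injOn S.ρbar hle hinj φm hcm
  -- the finite exceptional sets: `ℓ ≠ p`, `v ∉ S₀ ∪ Σ(F)`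
  have hSigfin : {v : HeightOneSpectrum (𝓞 K) | (Sum.inr v : Place K) ∈ S.Sigma}.Finite :=
    (S.Sigma.finite_toSet.preimage Sum.inr_injective.injOn)
  obtain ⟨ℓ, hℓ, hℓB, hinert, w, hwS, hℓw, -, g, hg, hxΛ, hcyc, hdvd, -, -, 𝔔, h𝔔, hFrob, -, hcrit,
      hlocp, hlocm⟩ :=
    ResidualTau.exists_inert_prime_localization_ne_zero hC hy.imagQuad (S.A j)
      (S.isScalarLinear_rhobar hy j) (hy.h1 j).2.1 (hy.h5a j) (S.isUnit_two hy j) hΛo hΛn hΛc hΛt'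
      φp φm (fun g _ => hφp g) (fun g _ => hφm g) hnep hnem {p} (hS₀.union hSigfin)
  have hℓp : ℓ ≠ p := fun h => hℓB (Finset.mem_singleton.mpr h)
  have hwS₀ : w ∉ S₀ := fun h => hwS (Or.inl h)
  have hwSig : (Sum.inr w : Place K) ∉ S.Sigma := fun h => hwS (Or.inr h)
  -- `p^s ∣ ℓ + 1`: `g ∈ Λ` fixes `μ_{p^s}`
  have hps : p ^ s ∣ ℓ + 1 := by
    refine hdvd (p ^ s) (fun h => hℓp ?_) (fun ζ hζ => hΛμ g hg ζ hζ)
    exact (Nat.prime_dvd_prime_iff_eq hℓ hp).mp (hℓ.dvd_of_dvd_pow h)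
  -- the Frobenius `g^τ g ∈ Λ` acts trivially on `T^{(j)}`
  have hFj : ∀ x : N j, S.T.ρ j (S.cd.conj g * g) x = x := hΛt _ hxΛ
  have hmem : w ∈ S.T.kolyvaginPrimes p s :=
    S.mem_kolyvaginPrimes_of_isArithFrobAtPlace hy hy.imagQuad.1 hℓ hℓp hinert hℓw hwSig hps hj
      ⟨𝔔, h𝔔, hFrob⟩ hFj
  exact ⟨w, hwS₀, hwSig, hLs hmem, hmem, g, hFj, 𝔔, h𝔔, hFrob, hcrit, hlocp, hlocm⟩

/-! ## §3 One eigenclass -/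

/-- **Howard 2004, Lemma 1.6.2 in `DVRSetting` currency, one class** («the other case being entirely
similar»): for ONE cocycle `φ` with `φ(g^τ) = θ(φ g)` for all `g` (a `(+)`-class; for a `(−)`-class
use `-θ`, via `hsign`) and non-zero class, the same package: `v ∉ S₀ ∪ Σ(F)`, `v ∈ 𝓛 ∩ 𝓛_s(T)`,
a Frobenius `g^τ g` at `𝔔 ∣ v` trivial on `T^{(j)}`, the evaluation criterion, and `loc_v [φ] ≠ 0`.
[cite: Howard2004HeegnerKolyvagin, Lemma 1.6.2 (arXiv:1202.6340 Lemma 2.6.2, p. 11 L30–58)] -/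
theorem exists_mem_primes_localization_ne_zero_single [Finite Nbar] [∀ k, Finite (N k)]
    (S : DVRSetting p K R N Rk Nbar Nq) (hy : S.SatisfiesH) (hC : Automorphic.chebotarev_artinRep)
    {s : ℕ} (hLs : S.T.kolyvaginPrimes p s ⊆ S.L) {j : ℕ}
    (hj : IsLocalRing.maximalIdeal R ^ S.e j ≤ Ideal.span {((p : ℕ) : R) ^ s})
    (φ : contOneCocycles S.ρbar.toTopRep) {ε : Rk j} (hsign : ε = 1 ∨ ε = -1)
    (hφ : ∀ g, φ.1 (S.cd.conj g) = ε • (S.A j).θ (φ.1 g))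
    (hc : oneCocycleClass S.ρbar.toTopRep φ ≠ 0)
    {S₀ : Set (HeightOneSpectrum (𝓞 K))} (hS₀ : S₀.Finite) :
    ∃ v : HeightOneSpectrum (𝓞 K), v ∉ S₀ ∧ (Sum.inr v : Place K) ∉ S.Sigma ∧ v ∈ S.L ∧
      v ∈ S.T.kolyvaginPrimes p s ∧
      ∃ g : absoluteGaloisGroup K, (∀ x : N j, S.T.ρ j (S.cd.conj g * g) x = x) ∧
        ∃ 𝔔 ∈ v.primesAbove, IsArithFrobAt (𝓞 K) (S.cd.conj g * g) 𝔔 ∧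
          (∀ ψ : contOneCocycles S.ρbar.toTopRep,
            (∀ i ∈ 𝔔.inertia (absoluteGaloisGroup K), ψ.1 i = 0) →
              (galoisCohomology.localization S.ρbar (Sum.inr v) 1 (oneCocycleClass S.ρbar.toTopRep ψ)
                = 0 ↔ ψ.1 (S.cd.conj g * g) = 0)) ∧
          galoisCohomology.localization S.ρbar (Sum.inr v) 1 (oneCocycleClass S.ρbar.toTopRep φ)
            ≠ 0 := by
  have hp : p.Prime := Fact.out
  haveI : NeZero (p ^ s) := ⟨pow_ne_zero s hp.ne_zero⟩
  obtain ⟨Λ, hΛo, hΛn, hΛc, hΛt, hΛμ, hΛle⟩ := S.cd.exists_standard_open_subgroup (S.T.ρ j) (p ^ s)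
  have hΛt' : ∀ g ∈ Λ, ∀ x : Nbar, S.ρbar g x = x :=
    fun g hg => S.rhobar_apply_eq_of_forall_apply_eq hy j (hΛt g hg)
  obtain ⟨ΓF, -, -, hFc, hFt, hinj⟩ := hy.h2
  have hle : ΓF ⊓ (⨅ n : ℕ, (DiscreteGaloisModule.mu K (p ^ n)).ker) ≤ Λ :=
    hΛle ΓF _ hFc (fun g hg x => hFt j g hg x) (iInf_ker_mu_le_ker_mu_pow p s)
  have hne : ∃ g ∈ Λ, φ.1 g ≠ 0 :=
    exists_mem_apply_ne_zero_of_resSubgroup_injOn S.ρbar hle hinj φ hc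
  -- the `R_j`-linear map `L = ε θ` and its fixed vector from H.5(a)
  obtain ⟨xp, hxp0, hxp, xm, hxm0, hxm, -⟩ := hy.h5a j
  obtain ⟨v₀, hv₀, hLv₀⟩ : ∃ v₀ : Nbar, v₀ ≠ 0 ∧ (ε • (S.A j).θ) v₀ = v₀ := by
    rcases hsign with rfl | rfl
    · exact ⟨xp, hxp0, by rw [one_smul, hxp]⟩
    · exact ⟨xm, hxm0, by rw [LinearMap.smul_apply, hxm, neg_smul, one_smul, neg_neg]⟩
  have hSigfin : {v : HeightOneSpectrum (𝓞 K) | (Sum.inr v : Place K) ∈ S.Sigma}.Finite :=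
    (S.Sigma.finite_toSet.preimage Sum.inr_injective.injOn)
  obtain ⟨ℓ, hℓ, hℓB, hinert, w, hwS, hℓw, -, g, hg, hxΛ, hcyc, hdvd, -, 𝔔, h𝔔, hFrob, -, hcrit,
      hloc⟩ :=
    ResidualTau.exists_inert_prime_localization_ne_zero_single hC hy.imagQuad S.cd S.ρbar
      (S.isScalarLinear_rhobar hy j) (hy.h1 j).2.1 (S.isUnit_two hy j) (ε • (S.A j).θ) hv₀ hLv₀ hΛo
      hΛn hΛc hΛt' φ (fun g _ => by rw [hφ g, LinearMap.smul_apply]) hne {p} (hS₀.union hSigfin)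
  have hℓp : ℓ ≠ p := fun h => hℓB (Finset.mem_singleton.mpr h)
  have hwS₀ : w ∉ S₀ := fun h => hwS (Or.inl h)
  have hwSig : (Sum.inr w : Place K) ∉ S.Sigma := fun h => hwS (Or.inr h)
  have hps : p ^ s ∣ ℓ + 1 := by
    refine hdvd (p ^ s) (fun h => hℓp ?_) (fun ζ hζ => hΛμ g hg ζ hζ)
    exact (Nat.prime_dvd_prime_iff_eq hℓ hp).mp (hℓ.dvd_of_dvd_pow h)
  have hFj : ∀ x : N j, S.T.ρ j (S.cd.conj g * g) x = x := hΛt _ hxΛ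
  have hmem : w ∈ S.T.kolyvaginPrimes p s :=
    S.mem_kolyvaginPrimes_of_isArithFrobAtPlace hy hy.imagQuad.1 hℓ hℓp hinert hℓw hwSig hps hj
      ⟨𝔔, h𝔔, hFrob⟩ hFj
  exact ⟨w, hwS₀, hwSig, hLs hmem, hmem, g, hFj, 𝔔, h𝔔, hFrob, hcrit, hloc⟩

/-! ## §4 Both eigenclasses AND their sum (Lemma 1.6.4, Case i: «d, d⁺, and some element of H¹(K,T̄)⁻») -/

/-- **Lemma 1.6.2 on a `DVRSetting`, with the unramified-inertia clause and the SUM class exported.**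
Same hypotheses as `exists_mem_primes_localization_ne_zero`; the conclusion additionally records that
the inertia group `I_𝔔` acts trivially on `T̄` and kills `φ⁺, φ⁻` («the localizations are unramified»)
and that **`loc_v [φ⁺ + φ⁻] ≠ 0`** as well: at the chosen Frobenius `x = g^τ g` the values
`φ⁺(x) ∈ T̄⁺`, `φ⁻(x) ∈ T̄⁻` are non-zero `θ`-eigenvectors of opposite signs, so their sum is non-zero
(`ResidualTau.apply_add_apply_conj_mul_self_ne_zero`, `2 ∈ R×`) — the situation of Lemma 1.6.4,
Case i, where `loc_ℓ(d) ≠ 0` is needed for `d = d⁺ + d⁻`.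
[cite: Howard2004HeegnerKolyvagin, Lemma 1.6.2 and Lemma 1.6.4 Case i (arXiv p. 11 L30–58, p. 12 L1–13)] -/
theorem exists_mem_primes_localization_add_ne_zero [Finite Nbar] [∀ k, Finite (N k)]
    (S : DVRSetting p K R N Rk Nbar Nq) (hy : S.SatisfiesH) (hC : Automorphic.chebotarev_artinRep)
    {s : ℕ} (hLs : S.T.kolyvaginPrimes p s ⊆ S.L) {j : ℕ}
    (hj : IsLocalRing.maximalIdeal R ^ S.e j ≤ Ideal.span {((p : ℕ) : R) ^ s})
    (φp φm : contOneCocycles S.ρbar.toTopRep)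
    (hφp : ∀ g, φp.1 (S.cd.conj g) = (S.A j).θ (φp.1 g))
    (hφm : ∀ g, φm.1 (S.cd.conj g) = -(S.A j).θ (φm.1 g))
    (hcp : oneCocycleClass S.ρbar.toTopRep φp ≠ 0) (hcm : oneCocycleClass S.ρbar.toTopRep φm ≠ 0)
    {S₀ : Set (HeightOneSpectrum (𝓞 K))} (hS₀ : S₀.Finite) :
    ∃ v : HeightOneSpectrum (𝓞 K), v ∉ S₀ ∧ (Sum.inr v : Place K) ∉ S.Sigma ∧ v ∈ S.L ∧
      v ∈ S.T.kolyvaginPrimes p s ∧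
      ∃ g : absoluteGaloisGroup K, (∀ x : N j, S.T.ρ j (S.cd.conj g * g) x = x) ∧
        ∃ 𝔔 ∈ v.primesAbove, IsArithFrobAt (𝓞 K) (S.cd.conj g * g) 𝔔 ∧
          (∀ i ∈ 𝔔.inertia (absoluteGaloisGroup K),
            (∀ x, S.ρbar i x = x) ∧ φp.1 i = 0 ∧ φm.1 i = 0) ∧
          (∀ ψ : contOneCocycles S.ρbar.toTopRep,
            (∀ i ∈ 𝔔.inertia (absoluteGaloisGroup K), ψ.1 i = 0) →
              (galoisCohomology.localization S.ρbar (Sum.inr v) 1 (oneCocycleClass S.ρbar.toTopRep ψ)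
                = 0 ↔ ψ.1 (S.cd.conj g * g) = 0)) ∧
          galoisCohomology.localization S.ρbar (Sum.inr v) 1 (oneCocycleClass S.ρbar.toTopRep φp)
            ≠ 0 ∧
          galoisCohomology.localization S.ρbar (Sum.inr v) 1 (oneCocycleClass S.ρbar.toTopRep φm)
            ≠ 0 ∧
          galoisCohomology.localization S.ρbar (Sum.inr v) 1
            (oneCocycleClass S.ρbar.toTopRep (φp + φm)) ≠ 0 := by
  have hp : p.Prime := Fact.out
  haveI : NeZero (p ^ s) := ⟨pow_ne_zero s hp.ne_zero⟩
  obtain ⟨Λ, hΛo, hΛn, hΛc, hΛt, hΛμ, hΛle⟩ := S.cd.exists_standard_open_subgroup (S.T.ρ j) (p ^ s)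
  have hΛt' : ∀ g ∈ Λ, ∀ x : Nbar, S.ρbar g x = x :=
    fun g hg => S.rhobar_apply_eq_of_forall_apply_eq hy j (hΛt g hg)
  obtain ⟨ΓF, -, -, hFc, hFt, hinj⟩ := hy.h2
  have hle : ΓF ⊓ (⨅ n : ℕ, (DiscreteGaloisModule.mu K (p ^ n)).ker) ≤ Λ :=
    hΛle ΓF _ hFc (fun g hg x => hFt j g hg x) (iInf_ker_mu_le_ker_mu_pow p s)
  have hnep : ∃ g ∈ Λ, φp.1 g ≠ 0 :=
    exists_mem_apply_ne_zero_of_resSubgroup_injOn S.ρbar hle hinj φp hcp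
  have hnem : ∃ g ∈ Λ, φm.1 g ≠ 0 :=
    exists_mem_apply_ne_zero_of_resSubgroup_injOn S.ρbar hle hinj φm hcm
  have hSigfin : {v : HeightOneSpectrum (𝓞 K) | (Sum.inr v : Place K) ∈ S.Sigma}.Finite :=
    (S.Sigma.finite_toSet.preimage Sum.inr_injective.injOn)
  have htwo := S.isUnit_two hy j
  obtain ⟨ℓ, hℓ, hℓB, hinert, w, hwS, hℓw, -, g, hg, hxΛ, hcyc, hdvd, hxp, hxm, 𝔔, h𝔔, hFrob, hIV,
      hcrit, hlocp, hlocm⟩ :=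
    ResidualTau.exists_inert_prime_localization_ne_zero hC hy.imagQuad (S.A j)
      (S.isScalarLinear_rhobar hy j) (hy.h1 j).2.1 (hy.h5a j) htwo hΛo hΛn hΛc hΛt'
      φp φm (fun g _ => hφp g) (fun g _ => hφm g) hnep hnem {p} (hS₀.union hSigfin)
  have hℓp : ℓ ≠ p := fun h => hℓB (Finset.mem_singleton.mpr h)
  have hwS₀ : w ∉ S₀ := fun h => hwS (Or.inl h)
  have hwSig : (Sum.inr w : Place K) ∉ S.Sigma := fun h => hwS (Or.inr h)
  have hps : p ^ s ∣ ℓ + 1 := by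
    refine hdvd (p ^ s) (fun h => hℓp ?_) (fun ζ hζ => hΛμ g hg ζ hζ)
    exact (Nat.prime_dvd_prime_iff_eq hℓ hp).mp (hℓ.dvd_of_dvd_pow h)
  have hFj : ∀ x : N j, S.T.ρ j (S.cd.conj g * g) x = x := hΛt _ hxΛ
  have hmem : w ∈ S.T.kolyvaginPrimes p s :=
    S.mem_kolyvaginPrimes_of_isArithFrobAtPlace hy hy.imagQuad.1 hℓ hℓp hinert hℓw hwSig hps hj
      ⟨𝔔, h𝔔, hFrob⟩ hFj
  -- the sum class: `(φ⁺ + φ⁻)(x) ≠ 0` (opposite eigenvectors do not cancel)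
  have hsum : (φp + φm).1 (S.cd.conj g * g) ≠ 0 := by
    rw [Submodule.coe_add, ContinuousMap.add_apply]
    exact ResidualTau.apply_add_apply_conj_mul_self_ne_zero (S.A j) htwo hΛc hΛt' φp φm
      (fun g _ => hφp g) (fun g _ => hφm g) hg (Or.inl hxp)
  have hsumI : ∀ i ∈ 𝔔.inertia (absoluteGaloisGroup K), (φp + φm).1 i = 0 := fun i hi => by
    rw [Submodule.coe_add, ContinuousMap.add_apply, (hIV i hi).2.1, (hIV i hi).2.2, add_zero]
  exact ⟨w, hwS₀, hwSig, hLs hmem, hmem, g, hFj, 𝔔, h𝔔, hFrob, hIV, hcrit, hlocp, hlocm,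
    fun h => hsum ((hcrit (φp + φm) hsumI).mp h)⟩

end DVRSetting

end Literature.NumberTheory.GaloisCohomology.Howard2004

end
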